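import Summits.AtomisticToContinuum.Crystallization.Theorems.FrustratedLawDichotomyStrainedPatchWindowFamilies
import Summits.AtomisticToContinuum.Crystallization.Theorems.FrustratedLawDichotomyStrainedPatchHomLatticeBoxWindow

/-!
# The RECUT IS BUILT: finite re-indexing of the recut window, the presented bent instance, its separation, and the window-honest footprint
# (27623 strained-patch piece, T-side [CORE-FAR]; decomp-a2c lens-5 «RecutPairs», generation 54, step (R2) of critic row 994 (3))

`…RecutKinematics` proved the KINEMATIC half of (RFᴿ) «modulo the `Fin` re-indexing»: the inverse of `1 + A`, the conjugate bend
`b₁ ∘ (1+A) = (1+A) ∘ b₀ ∈ 𝓑₁`, the recut lattice `latSet φ ((1+A)G) ξ = (1+A) '' latSet φ G ξ`, and window separation.  This module BUILDS the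
recut instance as a term:

* §1 the `R`-window of a branch lattice `{v ∈ latSet φ G ξ | ‖v‖ ≤ R}` is FINITE (`‖G − 1‖ ≤ 1/4`, `‖ξ‖ ≤ 1/4`; index boxes of `…HomLatticeBox*`) and is
  enumerated injectively by some `Fin M` with the origin at a chosen index (`exists_skeleton`); translated, it is the homogeneous ball `homRange`;
* §2 over such a skeleton the `b`-bent instance `a ↦ y + b (w a)` is `PresentedBy φ b G ξ R` (`b 0 = 0` for polynomial bends);
* §3 ★ the recut of a presented chart: for `b₀ ∈ 𝓑₀`, `‖G − 1‖ ≤ 9/50`, `‖ξ‖ ≤ 1/4`, `‖A‖ ≤ 1/150` the matrix `(1+A)G` stays in the `1/4`-box, and the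
  instance presented by `(φ, b₁, (1+A)G, ξ)` EXISTS, is a `𝓑₁`-bent `133/10`-ball, and — given window separation of the chart's bent lattice on the
  BENT `16`-window — is INJECTIVE and `7/10`-SEPARATED (`exists_recut`); with an `η₃₀`-good centre it lies in the window-honest comparison family
  `𝓘₁ʷ = CompFamilyW` (`compFamilyW_recut`), and it is `RecutNear` its chart (`recutNear_recut`);
* §4 ★ THE FOOTPRINT, WINDOW-HONEST: `InteriorChartW 𝓑₀ β ς s` = `InteriorChart` with the separation window widened from the bent `27/2`-window to
  the bent `16`-window.  REASON (the separation twin of the rim crack, found while building): the recut instance's sites are the bent images of ALL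
  skeleton vectors `v` with `‖(1+A)v‖ ≤ 133/10`, i.e. `‖v‖ ≤ 27/2`, whose `𝓑₀`-bent images have norm up to `27/2 + (27/2)²/200 + (27/2)³/2000 ≈ 15.65`
  — NOT covered by a separation clause cut at bent norm `27/2`; cut at `16` it covers them (`norm_bends0_le_sixteen`), and
  `(1 − 1/150)·(3/4) ≥ 7/10`.  `InteriorChartW → InteriorChart` (`interiorChart_of_W`), so every family and leaf pinned on it is a restriction of the
  `…RecutRecord` §B ones; ★★ `exists_recut_of_interiorChartW`: every chart with the footprint admits, for every `‖A‖ ≤ κL₀·t` (`0 ≤ t ≤ 1/60`) and every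
  centre `y`, a recut instance that is `RecutNear`, injective, separated, `𝓑₁`-bent, in `𝓘₁ʷ` once `η₃₀`-good, with its sites listed explicitly
  (the data (R1)/(R5)/(R6) consume).

What remains of (RFᴿ-bentW) after this module: (R1) the least-squares bound `‖A_LS‖ ≤ κL₀·t` + `projectedFree`, (R5) the coarse chart `τ₁ = 7/20` by the
recut (labels through the skeleton; arithmetic `1/4 + 6.55/150 ≤ 7/20` recorded in the memo), (R6) `LevelNear (1/3)`, (R7) the centre's goodness `0.068 < 7/100`.
No sorry, no new axioms, no cite tokens, no instances / notation.  `--supports stmt-AtomisticToContinuum-27623`.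
-/

noncomputable section

namespace Summit.AtomisticToContinuum.Crystallization.Theorems.FrustratedLawDichotomyStrainedPatchRecutBuild

open scoped BigOperators Classical
open Summit.AtomisticToContinuum.Crystallization.Theorems.FrustratedLawDichotomyPeriodicBlockFlags (goodAtScale_mono)
open Summit.AtomisticToContinuum.Crystallization.Theorems.FrustratedLawDichotomyRangeCut (Sep)
open Summit.AtomisticToContinuum.Crystallization.Theorems.FrustratedLawDichotomyMotifLemmas
open Summit.AtomisticToContinuum.Crystallization.Theorems.FrustratedLawDichotomyAveragingCut
open Summit.AtomisticToContinuum.Crystallization.Theorems.FrustratedLawDichotomyAveragingRuleCap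
open Summit.AtomisticToContinuum.Crystallization.Theorems.FrustratedLawDichotomyAveragingRuleTightFree
open Summit.AtomisticToContinuum.Crystallization.Theorems.FrustratedLawDichotomyExemptDoor (SitePred)
open Summit.AtomisticToContinuum.Crystallization.Theorems.FrustratedLawDichotomyExemptAbsorption
open Summit.AtomisticToContinuum.Crystallization.Theorems.FrustratedLawDichotomyExemptAbsorptionRecord
open Summit.AtomisticToContinuum.Crystallization.Theorems.FrustratedLawDichotomyCollarCensus
open Summit.AtomisticToContinuum.Crystallization.Theorems.FrustratedLawDichotomyCollarCensusKappa
open Summit.AtomisticToContinuum.Crystallization.Theorems.FrustratedLawDichotomyStrainedPatchHomSplit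
open Summit.AtomisticToContinuum.Crystallization.Theorems.FrustratedLawDichotomyStrainedPatchCleanCollar
open Summit.AtomisticToContinuum.Crystallization.Theorems.FrustratedLawDichotomyStrainedPatchHomTube
open Summit.AtomisticToContinuum.Crystallization.Theorems.FrustratedLawDichotomyStrainedPatchHomIsometry
open Summit.AtomisticToContinuum.Crystallization.Theorems.FrustratedLawDichotomyStrainedPatchHomTubeIso
open Summit.AtomisticToContinuum.Crystallization.Theorems.FrustratedLawDichotomyStrainedPatchPhaseCut
open Summit.AtomisticToContinuum.Crystallization.Theorems.FrustratedLawDichotomyStrainedPatchCoreTube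
open Summit.AtomisticToContinuum.Crystallization.Theorems.FrustratedLawDichotomyStrainedPatchCoreTubeRecord
open Summit.AtomisticToContinuum.Crystallization.Theorems.FrustratedLawDichotomyStrainedPatchCoreTubeMilli
open Summit.AtomisticToContinuum.Crystallization.Theorems.FrustratedLawDichotomyStrainedPatchStrainBands
open Summit.AtomisticToContinuum.Crystallization.Theorems.FrustratedLawDichotomyStrainedPatchChartFamilies
open Summit.AtomisticToContinuum.Crystallization.Theorems.FrustratedLawDichotomyStrainedPatchChartFamiliesBent
open Summit.AtomisticToContinuum.Crystallization.Theorems.FrustratedLawDichotomyStrainedPatchChartFamiliesPinned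
open Summit.AtomisticToContinuum.Crystallization.Theorems.FrustratedLawDichotomyStrainedPatchEnvelopeLaw
open Summit.AtomisticToContinuum.Crystallization.Theorems.FrustratedLawDichotomyStrainedPatchEnvelopeTaylor
open Literature.Barriers.AtomisticToContinuum.FlatleyTheil2015 (fccVec)
open Summit.AtomisticToContinuum.Crystallization.Theorems.FrustratedLawDichotomyStrainedPatchRecutPairs
open Summit.AtomisticToContinuum.Crystallization.Theorems.FrustratedLawDichotomyStrainedPatchRecutKinematics
open Literature.Barriers.AtomisticToContinuum.FlatleyTheil2015 (fccPoint)
open Summit.AtomisticToContinuum.Crystallization.Theorems.FrustratedLawDichotomyStrainedPatchHomRelief (latPt_fccVec_eq)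
open Summit.AtomisticToContinuum.Crystallization.Theorems.FrustratedLawDichotomyStrainedPatchHomLatticeBox (norm_apply_ge_of_near_one latPt_zero
  mem_box_of_norm_fccPoint_lt)
open Summit.AtomisticToContinuum.Crystallization.Theorems.FrustratedLawDichotomyStrainedPatchHomLatticeBoxHcp (latPt_eq_apply_one shifted_eq_apply)
open Summit.AtomisticToContinuum.Crystallization.Theorems.FrustratedLawDichotomyStrainedPatchHomLatticeBoxWindow (mem_box_of_norm_hexPt_lt'
  mem_box_of_norm_hexPt_add_shift_lt')
open Summit.AtomisticToContinuum.Crystallization.Theorems.FrustratedLawDichotomyStrainedPatchWindowFamilies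

/-! ## §1. The lattice window is finite and is enumerated by a `Fin M` -/

/-- ★ **The `R`-window of a branch lattice is finite** (`‖G − 1‖ ≤ 1/4`, `‖ξ‖ ≤ 1/4`): its index vectors lie in a coordinate box (`…HomLatticeBox`,
`…HomLatticeBoxWindow`). [folklore] -/
theorem latWindow_finite (φ : Bool) {G : E3 →L[ℝ] E3} {ξ : E3} (hG : ‖G - 1‖ ≤ 1 / 4) (hξ : ‖ξ‖ ≤ 1 / 4) (R : ℝ) :
    {v : E3 | v ∈ latSet φ G ξ ∧ ‖v‖ ≤ R}.Finite := by
  obtain ⟨K, hK⟩ := exists_nat_gt (4 * (|R| + 2))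
  set box : Finset (Fin 3 → ℤ) := Fintype.piFinset fun _ : Fin 3 => Finset.Icc (-(K : ℤ)) K with hbox
  have hR : R ≤ |R| := le_abs_self R
  have habs : 0 ≤ |R| := abs_nonneg R
  have h1 : 8 * (|R| + 1) ^ 2 < 3 * ((K : ℝ) + 1) ^ 2 := by nlinarith
  have h2 : 4 * (4 / 3 * (|R| + 1)) ^ 2 < 3 * ((K : ℝ) + 1) ^ 2 := by nlinarith
  have h3 : 16 * (4 / 3 * (|R| + 1) + 1 / 4) ^ 2 < 3 * (2 * (K : ℝ) + 1) ^ 2 := by nlinarith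
  cases φ
  · refine ((box.image (latPt G hexFrame)) ∪ (box.image fun b => latPt G hexFrame b + G (hcpShift + ξ))).finite_toSet.subset ?_
    rintro v ⟨hv, hvR⟩
    simp only [latSet, cond_false, Set.mem_setOf_eq] at hv
    obtain ⟨b, hb | hb⟩ := hv
    · have hnorm : ‖latPt 1 hexFrame b‖ < 4 / 3 * (|R| + 1) := by
        have h34 := norm_apply_ge_of_near_one hG (latPt 1 hexFrame b)
        rw [← latPt_eq_apply_one, ← hb] at h34
        linarith
      simp only [Finset.coe_union, Finset.coe_image, Set.mem_union, Set.mem_image, Finset.mem_coe]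
      exact Or.inl ⟨b, mem_box_of_norm_hexPt_lt' h2 hnorm, hb.symm⟩
    · have hnorm : ‖latPt 1 hexFrame b + hcpShift‖ < 4 / 3 * (|R| + 1) + 1 / 4 := by
        have h34 := norm_apply_ge_of_near_one hG (latPt 1 hexFrame b + hcpShift + ξ)
        rw [← shifted_eq_apply, ← hb] at h34
        have htri : ‖latPt 1 hexFrame b + hcpShift‖ ≤ ‖latPt 1 hexFrame b + hcpShift + ξ‖ + ‖ξ‖ := by
          simpa only [add_sub_cancel_right] using norm_sub_le (latPt 1 hexFrame b + hcpShift + ξ) ξ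
        linarith
      simp only [Finset.coe_union, Finset.coe_image, Set.mem_union, Set.mem_image, Finset.mem_coe]
      exact Or.inr ⟨b, mem_box_of_norm_hexPt_add_shift_lt' h3 hnorm, hb.symm⟩
  · refine (box.image (latPt G fccVec)).finite_toSet.subset ?_
    rintro v ⟨hv, hvR⟩
    simp only [latSet, cond_true, Set.mem_setOf_eq] at hv
    obtain ⟨b, hb⟩ := hv
    have hnorm : ‖fccPoint b‖ < 4 / 3 * (|R| + 1) := by
      have h34 := norm_apply_ge_of_near_one hG (fccPoint b)
      rw [← latPt_fccVec_eq, ← hb] at h34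
      linarith
    simp only [Finset.coe_image, Set.mem_image, Finset.mem_coe]
    exact ⟨b, mem_box_of_norm_fccPoint_lt h1 hnorm, hb.symm⟩

/-- A finite point set containing `x` is the range of an injective `Fin M`-family taking the value `x` at some index. [formal bookkeeping] -/
theorem exists_enum {S : Set E3} (hS : S.Finite) {x : E3} (hx : x ∈ S) :
    ∃ (M : ℕ) (w : Fin M → E3) (c : Fin M), Function.Injective w ∧ Set.range w = S ∧ w c = x := by
  obtain ⟨M, f, hf⟩ := hS.fin_embedding
  rw [← hf] at hx
  obtain ⟨c, hc⟩ := hx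
  exact ⟨M, f, c, f.injective, hf, hc⟩

/-- The origin is a lattice vector on either branch. [formal bookkeeping] -/
theorem zero_mem_latSet (φ : Bool) (G : E3 →L[ℝ] E3) (ξ : E3) : (0 : E3) ∈ latSet φ G ξ := by
  cases φ
  · simp only [latSet, cond_false, Set.mem_setOf_eq]
    exact ⟨0, Or.inl (latPt_zero G hexFrame).symm⟩
  · simp only [latSet, cond_true, Set.mem_setOf_eq]
    exact ⟨0, (latPt_zero G fccVec).symm⟩

/-- ★ **THE SKELETON** — the `R`-window (`0 ≤ R`) of a branch lattice in the `1/4`-box is enumerated injectively by some `Fin M`, the origin at a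
distinguished index `c`. [formal bookkeeping] -/
theorem exists_skeleton (φ : Bool) {G : E3 →L[ℝ] E3} {ξ : E3} (hG : ‖G - 1‖ ≤ 1 / 4) (hξ : ‖ξ‖ ≤ 1 / 4) {R : ℝ} (hR : 0 ≤ R) :
    ∃ (M : ℕ) (w : Fin M → E3) (c : Fin M), Function.Injective w ∧ Set.range w = {v : E3 | v ∈ latSet φ G ξ ∧ ‖v‖ ≤ R} ∧ w c = 0 :=
  exists_enum (latWindow_finite φ hG hξ R) ⟨zero_mem_latSet φ G ξ, by rwa [norm_zero]⟩

/-- The translated skeleton is the homogeneous `R`-ball about the translate. [formal bookkeeping] -/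
theorem range_shift_eq_homRange {φ : Bool} {G : E3 →L[ℝ] E3} {ξ : E3} {R : ℝ} {M : ℕ} {w : Fin M → E3}
    (hr : Set.range w = {v : E3 | v ∈ latSet φ G ξ ∧ ‖v‖ ≤ R}) (x₀ : E3) : Set.range (fun a => x₀ + w a) = homRange φ G ξ R x₀ := by
  ext x
  rw [mem_homRange_iff]
  constructor
  · rintro ⟨a, rfl⟩
    have ha : w a ∈ Set.range w := ⟨a, rfl⟩
    rw [hr] at ha
    exact ⟨by rw [dist_eq_norm, add_sub_cancel_left]; exact ha.2, by rw [add_sub_cancel_left]; exact ha.1⟩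
  · rintro ⟨hd, hlat⟩
    have hx : x - x₀ ∈ Set.range w := by
      rw [hr]
      exact ⟨hlat, by rwa [dist_eq_norm] at hd⟩
    obtain ⟨a, ha⟩ := hx
    exact ⟨a, show x₀ + w a = x by rw [ha, add_sub_cancel]⟩

/-! ## §2. The bent instance over a skeleton is presented -/

/-- A polynomial bend fixes the centre: `b 0 = 0`. [formal bookkeeping] -/
theorem polyBend_zero {q₂ q₃ : ℝ} {b : E3 → E3} (hb : b ∈ polyBends q₂ q₃) : b 0 = 0 := by
  obtain ⟨Q, C, -, -, hb⟩ := hb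
  simp only [hb, map_zero, add_zero]

/-- ★ **THE BENT INSTANCE IS PRESENTED** — over a skeleton `w` of the `R`-window (origin at `c`), the instance `a ↦ y + b (w a)` is
`PresentedBy φ b G ξ R` with centre index `c` (any base point `y`; `b 0 = 0`). [formal bookkeeping] -/
theorem presentedBy_bent {φ : Bool} {b : E3 → E3} (hb0 : b 0 = 0) {G : E3 →L[ℝ] E3} {ξ : E3} (hG : ‖G - 1‖ ≤ 1 / 4) (hξ : ‖ξ‖ ≤ 1 / 4) {R : ℝ}
    {M : ℕ} {w : Fin M → E3} {c : Fin M} (hr : Set.range w = {v : E3 | v ∈ latSet φ G ξ ∧ ‖v‖ ≤ R}) (hc : w c = 0) (y : E3) :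
    PresentedBy φ b G ξ R (fun a => y + b (w a)) c := by
  refine ⟨hG, hξ, fun a => y + w a, ?_, fun a => ?_⟩
  · have h := range_shift_eq_homRange hr y
    simpa only [hc, add_zero] using h
  · simp only [hc, hb0, add_zero, add_sub_cancel_left]

/-! ## §3. The recut of a presented chart: matrix box, bent radius, separation, existence, membership -/

/-- The recut matrix stays in the `1/4`-box: `‖G − 1‖ ≤ 9/50 ∧ ‖A‖ ≤ 1/150 ⟹ ‖(1+A)G − 1‖ ≤ 9/50 + (1/150)(59/50) ≤ 1/4`. [formal bookkeeping] -/
theorem norm_recut_matrix_sub_one_le {G A : E3 →L[ℝ] E3} (hG : ‖G - 1‖ ≤ 9 / 50) (hA : ‖A‖ ≤ 1 / 150) :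
    ‖((1 : E3 →L[ℝ] E3) + A) * G - 1‖ ≤ 1 / 4 := by
  have hG' : ‖G‖ ≤ 59 / 50 := by
    calc ‖G‖ = ‖(G - 1) + 1‖ := by rw [sub_add_cancel]
      _ ≤ ‖G - 1‖ + ‖(1 : E3 →L[ℝ] E3)‖ := norm_add_le _ _
      _ ≤ 9 / 50 + 1 := add_le_add hG (by rw [ContinuousLinearMap.one_def]; exact ContinuousLinearMap.norm_id_le)
      _ = 59 / 50 := by norm_num
  have hAG : ‖A * G‖ ≤ 1 / 150 * (59 / 50) :=
    (norm_mul_le _ _).trans (mul_le_mul hA hG' (norm_nonneg _) (by norm_num))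
  calc ‖((1 : E3 →L[ℝ] E3) + A) * G - 1‖ = ‖(G - 1) + A * G‖ := by rw [add_mul, one_mul, add_sub_right_comm]
    _ ≤ ‖G - 1‖ + ‖A * G‖ := norm_add_le _ _
    _ ≤ 9 / 50 + 1 / 150 * (59 / 50) := add_le_add hG hAG
    _ ≤ 1 / 4 := by norm_num

/-- A `𝓑₀`-bent image of a skeleton vector of norm `≤ 27/2` has norm `≤ 16` (`27/2 + (27/2)²/200 + (27/2)³/2000 = 15.641…`). [formal bookkeeping] -/
theorem norm_bends0_le_sixteen {b : E3 → E3} (hb : b ∈ bends0) {v : E3} (hv : ‖v‖ ≤ 27 / 2) : ‖b v‖ ≤ 16 := by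
  have h := norm_polyBend_le (q₂ := 1 / 200) (q₃ := 1 / 2000) (by simpa [bends0] using hb) v
  have h0 : 0 ≤ ‖v‖ := norm_nonneg v
  have h2 : ‖v‖ ^ 2 ≤ (27 / 2) ^ 2 := pow_le_pow_left₀ h0 hv 2
  have h3 : ‖v‖ ^ 3 ≤ (27 / 2) ^ 3 := pow_le_pow_left₀ h0 hv 3
  nlinarith

/-- ★ **SEPARATION OF THE RECUT, ALL SITES** — window separation `3/4` of the chart's `𝓑₀`-bent lattice on the BENT `16`-window and `‖A‖ ≤ 1/150` give
`7/10 ≤ dist ((1+A)(b v), (1+A)(b v'))` for all distinct lattice vectors of SKELETON norm `≤ 27/2` — which is every site of the recut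
(`…RecutKinematics.norm_le_window`). [folklore] -/
theorem sep_recut_sixteen {φ : Bool} {b : E3 → E3} {G : E3 →L[ℝ] E3} {ξ : E3} (hW : WindowSep φ b G ξ 16 (3 / 4)) (hb : b ∈ bends0)
    (A : E3 →L[ℝ] E3) (hA : ‖A‖ ≤ 1 / 150) {v v' : E3} (hv : v ∈ latSet φ G ξ) (hv' : v' ∈ latSet φ G ξ) (hne : v ≠ v')
    (hR : ‖v‖ ≤ 27 / 2) (hR' : ‖v'‖ ≤ 27 / 2) : 7 / 10 ≤ dist (((1 : E3 →L[ℝ] E3) + A) (b v)) (((1 : E3 →L[ℝ] E3) + A) (b v')) := by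
  have h := windowSep_recut hW A hA (by norm_num) hv hv' hne (norm_bends0_le_sixteen hb hR) (norm_bends0_le_sixteen hb hR')
  linarith

/-- ★★ **THE RECUT EXISTS** — for a chart presentation `(φ, b₀ ∈ 𝓑₀, G, ξ)` with `‖G − 1‖ ≤ 9/50`, `‖ξ‖ ≤ 1/4`, window separation `3/4` on the bent
`16`-window, every `‖A‖ ≤ 1/150` and every base point `y`: a conjugate bend `b₁ ∈ 𝓑₁`, an injective skeleton `w` of the `133/10`-window of the recut
lattice `latSet φ ((1+A)G) ξ` (origin at `c₁`), and the instance `a ↦ y + b₁ (w a)` — presented by `(φ, b₁, (1+A)G, ξ)`, a `𝓑₁`-bent `133/10`-ball,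
INJECTIVE and `7/10`-SEPARATED. [folklore] -/
theorem exists_recut {φ : Bool} {b₀ : E3 → E3} {G : E3 →L[ℝ] E3} {ξ : E3} (hb₀ : b₀ ∈ bends0) (hG : ‖G - 1‖ ≤ 9 / 50) (hξ : ‖ξ‖ ≤ 1 / 4)
    (hW : WindowSep φ b₀ G ξ 16 (3 / 4)) (A : E3 →L[ℝ] E3) (hA : ‖A‖ ≤ 1 / 150) (y : E3) :
    ∃ (b₁ : E3 → E3) (M₁ : ℕ) (w : Fin M₁ → E3) (c₁ : Fin M₁), b₁ ∈ bends1 ∧ (∀ v, b₁ (((1 : E3 →L[ℝ] E3) + A) v) = ((1 : E3 →L[ℝ] E3) + A) (b₀ v)) ∧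
      Function.Injective w ∧ Set.range w = {u : E3 | u ∈ latSet φ (((1 : E3 →L[ℝ] E3) + A) * G) ξ ∧ ‖u‖ ≤ 133 / 10} ∧ w c₁ = 0 ∧
      PresentedBy φ b₁ (((1 : E3 →L[ℝ] E3) + A) * G) ξ (133 / 10) (fun a => y + b₁ (w a)) c₁ ∧
      IsBentBall bends1 (133 / 10) (fun a => y + b₁ (w a)) c₁ ∧ Function.Injective (fun a => y + b₁ (w a)) ∧ Sep (fun a => y + b₁ (w a)) := by
  obtain ⟨b₁, hb₁, hconj⟩ := exists_conj_bends1 hb₀ A hA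
  have hG₁ := norm_recut_matrix_sub_one_le hG hA
  obtain ⟨M₁, w, c₁, hinj, hr, hc⟩ := exists_skeleton φ hG₁ hξ (R := 133 / 10) (by norm_num)
  have hP := presentedBy_bent (polyBend_zero (q₂ := 11 / 2000) (q₃ := 11 / 20000) (by simpa [bends1] using hb₁)) hG₁ hξ hr hc y
  -- every skeleton vector is `(1+A) v` with `v` a chart lattice vector of norm `≤ 27/2`
  have hsite : ∀ a, ∃ v ∈ latSet φ G ξ, w a = ((1 : E3 →L[ℝ] E3) + A) v ∧ ‖v‖ ≤ 27 / 2 := by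
    intro a
    have ha : w a ∈ Set.range w := ⟨a, rfl⟩
    rw [hr] at ha
    obtain ⟨hlat, hnorm⟩ := ha
    rw [latSet_mul] at hlat
    obtain ⟨v, hv, hva⟩ := hlat
    exact ⟨v, hv, hva.symm, norm_le_window A hA (by rwa [hva])⟩
  have hsep : Sep (fun a => y + b₁ (w a)) := by
    intro a a' hne
    obtain ⟨v, hv, hva, hvn⟩ := hsite a
    obtain ⟨v', hv', hva', hvn'⟩ := hsite a'
    have hvv : v ≠ v' := by
      intro h
      exact hne (hinj (by rw [hva, hva', h]))
    have h := sep_recut_sixteen hW hb₀ A hA hv hv' hvv hvn hvn'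
    simpa only [dist_add_left, hva, hva', hconj] using h
  have hinj₁ : Function.Injective (fun a => y + b₁ (w a)) := by
    intro a a' h
    by_contra hne
    have h7 := hsep a a' hne
    simp only [h, dist_self] at h7
    norm_num at h7
  exact ⟨b₁, M₁, w, c₁, hb₁, hconj, hinj, hr, hc, hP, isBentBall_of_presentedBy hb₁ hP, hinj₁, hsep⟩

/-- The recut is `RecutNear` its chart (the pair relation of record, assembled). [formal bookkeeping] -/
theorem recutNear_recut {φ : Bool} {b₀ b₁ : E3 → E3} {G A : E3 →L[ℝ] E3} {ξ : E3} {κL t : ℝ} {M₀ : ℕ} {z₀ : Fin M₀ → E3} {c₀ : Fin M₀} {M₁ : ℕ}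
    {z₁ : Fin M₁ → E3} {c₁ : Fin M₁} (hb₀ : b₀ ∈ bends0) (hP₀ : PresentedBy φ b₀ G ξ (133 / 10) z₀ c₀) (hA : ‖A‖ ≤ κL * max t 0)
    (hconj : ∀ v, b₁ (((1 : E3 →L[ℝ] E3) + A) v) = ((1 : E3 →L[ℝ] E3) + A) (b₀ v))
    (hP₁ : PresentedBy φ b₁ (((1 : E3 →L[ℝ] E3) + A) * G) ξ (133 / 10) z₁ c₁) : RecutNear bends0 κL t z₀ c₀ z₁ c₁ :=
  ⟨φ, b₀, b₁, G, ξ, A, hb₀, hP₀, hA, hconj, hP₁⟩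

/-- ★ **MEMBERSHIP** — an injective, separated, `𝓑₁`-bent `133/10`-ball with an `η₃₀`-good centre lies in `𝓘₁ʷ = CompFamilyW` (rim-free:
`…WindowFamilies.compFamilyW_of_sepBent`). [formal bookkeeping] -/
theorem compFamilyW_recut {M₁ : ℕ} {z₁ : Fin M₁ → E3} {c₁ : Fin M₁} (hinj : Function.Injective z₁) (hsep : Sep z₁)
    (hbent : IsBentBall bends1 (133 / 10) z₁ c₁) (hgood : GoodAtScale eta30 (3 / 2) z₁ c₁) : CompFamilyW M₁ z₁ c₁ :=
  compFamilyW_of_sepBent subset_rfl hinj hsep hbent hgood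

/-! ## §4. The window-honest footprint `InteriorChartW` and the recut of every chart carrying it -/

/-- ★ **`InteriorChartW 𝓑₀ β ς s z₀ c₀`** [THE FOOTPRINT HYPOTHESIS, window-honest; chart side · INSTRUMENTABLE] — `InteriorChart` with the window
separation clause on the BENT `16`-WINDOW (covering the bent images of all skeleton vectors of norm `≤ 27/2`, i.e. every site a recut can have):
a presentation `(φ, b ∈ 𝓑₀, G, ξ)` with `‖G − 1‖ ≤ β`, `‖ξ‖ ≤ ς`, `WindowSep φ b G ξ 16 s`. -/
def InteriorChartW (𝓑₀ : Set (E3 → E3)) (β ς s : ℝ) {M₀ : ℕ} (z₀ : Fin M₀ → E3) (c₀ : Fin M₀) : Prop :=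
  ∃ (φ : Bool) (b : E3 → E3) (G : E3 →L[ℝ] E3) (ξ : E3), b ∈ 𝓑₀ ∧ PresentedBy φ b G ξ (133 / 10) z₀ c₀ ∧ ‖G - 1‖ ≤ β ∧ ‖ξ‖ ≤ ς ∧ WindowSep φ b G ξ 16 s

/-- Window separation is inherited by smaller windows. [formal bookkeeping] -/
theorem windowSep_anti {φ : Bool} {b : E3 → E3} {G : E3 →L[ℝ] E3} {ξ : E3} {R R' s : ℝ} (h : WindowSep φ b G ξ R' s) (hle : R ≤ R') :
    WindowSep φ b G ξ R s :=
  fun v hv v' hv' hne hR hR' => h v hv v' hv' hne (hR.trans hle) (hR'.trans hle)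

/-- The window-honest footprint implies the `…RecutPairs` footprint (`16 ≥ 27/2`): every family / leaf pinned on `InteriorChartW` is a restriction of the
§B objects of `…RecutRecord`. [formal bookkeeping] -/
theorem interiorChart_of_W {𝓑₀ : Set (E3 → E3)} {β ς s : ℝ} {M₀ : ℕ} {z₀ : Fin M₀ → E3} {c₀ : Fin M₀} (h : InteriorChartW 𝓑₀ β ς s z₀ c₀) :
    InteriorChart 𝓑₀ β ς s z₀ c₀ := by
  obtain ⟨φ, b, G, ξ, hb, hP, hG, hξ, hW⟩ := h
  exact ⟨φ, b, G, ξ, hb, hP, hG, hξ, windowSep_anti hW (by norm_num)⟩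

/-- ★★ **THE RECUT OF A CHART WITH THE FOOTPRINT** (pins `β₀ = 9/50`, `ς₀ = 1/10`, `s₀ = 3/4`, `κL₀ = 2/5`) — for `0 ≤ t ≤ 1/60`, every `‖A‖ ≤ κL₀·t` and every
base point `y` there is a recut instance centred at `y`: `RecutNear 𝓑₀ κL₀ t` its chart, injective, `7/10`-separated, a `𝓑₁`-bent `133/10`-ball, a member
of `𝓘₁ʷ` as soon as its centre is `η₃₀`-good, with its sites LISTED — the chart's presentation `(φ, b₀, G, ξ)`, the conjugate bend `b₁`, and an injective
skeleton `w` of the recut window with `z₁ a = y + b₁ (w a)`.  This is (R2) of the memo; (R1)/(R5)/(R6)/(R7) consume the listed data. [folklore] -/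
theorem exists_recut_of_interiorChartW {M₀ : ℕ} {z₀ : Fin M₀ → E3} {c₀ : Fin M₀} (h : InteriorChartW bends0 beta0 xi0 sep0 z₀ c₀) {t : ℝ}
    (ht : 0 ≤ t) (ht' : t ≤ 1 / 60) (A : E3 →L[ℝ] E3) (hA : ‖A‖ ≤ kL0 * max t 0) (y : E3) :
    ∃ (M₁ : ℕ) (z₁ : Fin M₁ → E3) (c₁ : Fin M₁), z₁ c₁ = y ∧ RecutNear bends0 kL0 t z₀ c₀ z₁ c₁ ∧ Function.Injective z₁ ∧ Sep z₁ ∧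
      IsBentBall bends1 (133 / 10) z₁ c₁ ∧ (GoodAtScale eta30 (3 / 2) z₁ c₁ → CompFamilyW M₁ z₁ c₁) ∧
      ∃ (φ : Bool) (b₀ b₁ : E3 → E3) (G : E3 →L[ℝ] E3) (ξ : E3) (w : Fin M₁ → E3), b₀ ∈ bends0 ∧ b₁ ∈ bends1 ∧
        PresentedBy φ b₀ G ξ (133 / 10) z₀ c₀ ∧ (∀ v, b₁ (((1 : E3 →L[ℝ] E3) + A) v) = ((1 : E3 →L[ℝ] E3) + A) (b₀ v)) ∧ Function.Injective w ∧
        Set.range w = {u : E3 | u ∈ latSet φ (((1 : E3 →L[ℝ] E3) + A) * G) ξ ∧ ‖u‖ ≤ 133 / 10} ∧ w c₁ = 0 ∧ ∀ a, z₁ a = y + b₁ (w a) := by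
  obtain ⟨φ, b₀, G, ξ, hb₀, hP₀, hG, hξ, hW⟩ := h
  have hA' : ‖A‖ ≤ 1 / 150 := hA.trans (kL0_mul_le ht ht')
  obtain ⟨b₁, M₁, w, c₁, hb₁, hconj, hinj, hr, hc, hP, hbent, hinj₁, hsep⟩ :=
    exists_recut hb₀ hG (hξ.trans (by norm_num [xi0])) (by simpa only [sep0] using hW) A hA' y
  refine ⟨M₁, fun a => y + b₁ (w a), c₁, ?_, recutNear_recut hb₀ hP₀ hA hconj hP, hinj₁, hsep, hbent, fun hgood => compFamilyW_recut hinj₁ hsep hbent hgood,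
    φ, b₀, b₁, G, ξ, w, hb₀, hb₁, hP₀, hconj, hinj, hr, hc, fun a => rfl⟩
  simp only [hc, polyBend_zero (q₂ := 11 / 2000) (q₃ := 11 / 20000) (by simpa [bends1] using hb₁), add_zero]

end Summit.AtomisticToContinuum.Crystallization.Theorems.FrustratedLawDichotomyStrainedPatchRecutBuild
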